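import Literature.Probability.RandomPlanarGeometry.SLEThrStoppedDriver
import Literature.Probability.RandomPlanarGeometry.SLEThrLevelMartingales
import HarnessLib

/-!
# The through-swallow image driving value of SLE₆ carries the through-swallow capacity clock

Conclusion of the gluing of the image driving martingales of SLE₆ through the swallow instants
(G. F. Lawler, O. Schramm, W. Werner, Acta Math. **187** (2001), Thm. 2.2 — locality of SLE₆; G. F. Lawler,
*Conformally Invariant Processes in the Plane* (2005), §6.3 Thm. 6.13, where the conformal image is followed
up to the exit of the neighbourhood THROUGH the instants at which whole pieces of the hull `A` are swallowed:
"`U*_t` is a continuous local martingale … hence a time change of `√6 ×` a Brownian motion"). Files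
`SLEThrPieces`, `SLEThrPieceMartingales`, `SLEThrIncrements`, `SLEThrLevelMartingales`,
`SLEThrStoppedDriver` contain the bookkeeping; here:

* `hasMartingaleClock_thrImageDriver` — **the theorem**: for a `*`-hull `A`, a cluster scale `δ > 0` and a
  horizon `H` (a stopping time of the Brownian filtration, bounded by the cap time `capTimeK 6 N` and by a
  constant `T₀`, up to which every `δ`-cluster of `A` is inside the closed hull or disjoint from it), the
  process `Y_t = (√6)⁻¹ U*_{t ∧ H}` (`U* = Loewner.thrImageDriver`, the through-swallow image driving value of
  the SLE₆ driving function `drvK 6 (brownianCPath ω)`) carries the martingale clock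
  `c_t = σ_A(t ∧ H)` (`σ_A = Loewner.thrClock`) in the sense of `Process.HasMartingaleClock`: `Y` and `Y² − c`
  are a.e. martingales (uniformly bounded limits of the level-`n` a.e. martingales, `IsAEMartingale.of_tendsto_ae`),
  `Y` is bounded, and the clock is nondecreasing and `1`-Lipschitz from `0` (`Loewner.thrClock_sub_mem`);
* `stronglyAdapted_thrY`, `continuous_thrY`, `adapted_thrClockProc` — the inputs of the Dambis–Dubins–Schwarz
  packaging (`SLEThrImageBM`): `Y` is strongly adapted with continuous paths and `c` is adapted
  (`stronglyAdapted_stoppedProcess_thrImageDriver`, `adapted_thrClock_min`: pointwise limits of the level-`n`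
  sums).

## References

* G. F. Lawler, O. Schramm, W. Werner, Acta Math. **187** (2001), Thm. 2.2. [LawlerSchrammWerner2001]
* G. F. Lawler (2005), §6.3 Thm. 6.13. [Lawler2005]
* D. Revuz, M. Yor (1999), Ch. IV (1.6)–(1.7), Ch. V (1.6). [RevuzYor1999]
-/

noncomputable section

open Set Filter Metric Function MeasureTheory
open _root_.Complex _root_.Topology
open scoped NNReal

namespace Literature.Probability.RandomPlanarGeometry

open Loewner Literature.Probability.Process

variable {κ : ℝ≥0} {A : Set ℂ} {δ : ℝ} {H : (ℝ≥0 → ℝ) → WithTop ℝ≥0}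

/-! ### Adaptedness, continuity and the martingale clock of the stopped through-swallow driving process -/

section Assembly

variable {N : ℕ} {T₀ : ℝ≥0}

/-- The clock argument: `min t ((H ω).untopD 0) = (t ∧ H ω)` read in `ℝ`. [folklore] -/
theorem min_untopD_eq {t : ℝ≥0} {x : WithTop ℝ≥0} (hx : x ≠ ⊤) :
    min (t : ℝ) ((x.untopD 0 : ℝ≥0) : ℝ) = (((min (t : WithTop ℝ≥0) x).untopA : ℝ≥0) : ℝ) := by
  obtain ⟨h, rfl⟩ := WithTop.ne_top_iff_exists.1 hx
  rw [WithTop.untopD_coe, ← WithTop.coe_min, ← NNReal.coe_min]; rfl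

/-- **The stopped through-swallow driving process is strongly adapted** (pointwise limit of the strongly
adapted level-`n` sums). [folklore] -/
theorem stronglyAdapted_stoppedProcess_thrImageDriver (hA : IsStarHull A) (hδ : 0 < δ)
    (hH : IsStoppingTime brownianFiltration H)
    (hclw : ∀ (ω : ℝ≥0 → ℝ) (t : ℝ≥0), (t : WithTop ℝ≥0) ≤ H ω → ∀ a ∈ A,
      deltaCluster A δ a ⊆ closedHull (drvK κ (brownianCPath ω)) t ∨ Disjoint (deltaCluster A δ a) (closedHull (drvK κ (brownianCPath ω)) t)) :
    StronglyAdapted brownianFiltration (stoppedProcess (fun t ω ↦ thrImageDriver (drvK κ (brownianCPath ω)) A t) H) := by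
  intro t
  have hf : ∀ n, StronglyMeasurable[brownianFiltration t] (thrLevelSum κ hA hδ H n t) := fun n ↦ by
    refine Finset.stronglyMeasurable_fun_sum _ fun s hs ↦ ?_
    have hs' := Finset.mem_powerset.1 hs
    have hprog := isStronglyProgressive_pieceMart (κ := κ) hs' n
    exact ((hprog.stronglyAdapted_stoppedProcess (isStoppingTime_thrSigma hH s)) t).sub
      ((hprog.stronglyAdapted_stoppedProcess (isStoppingTime_thrRho hH hs')) t)
  refine stronglyMeasurable_of_tendsto atTop hf (tendsto_pi_nhds.2 fun ω ↦ ?_)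
  exact tendsto_thrLevelSum (hclw ω) t

/-- **The through-swallow clock process is adapted** (pointwise limit of the adapted level-`n` clock sums).
[folklore] -/
theorem adapted_thrClock_min (hA : IsStarHull A) (hδ : 0 < δ) (hH : IsStoppingTime brownianFiltration H)
    (hHt : ∀ ω, H ω ≠ ⊤)
    (hclw : ∀ (ω : ℝ≥0 → ℝ) (t : ℝ≥0), (t : WithTop ℝ≥0) ≤ H ω → ∀ a ∈ A,
      deltaCluster A δ a ⊆ closedHull (drvK κ (brownianCPath ω)) t ∨ Disjoint (deltaCluster A δ a) (closedHull (drvK κ (brownianCPath ω)) t)) :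
    Adapted brownianFiltration fun t ω ↦ thrClock (drvK κ (brownianCPath ω)) A (min (t : ℝ) (((H ω).untopD 0 : ℝ≥0) : ℝ)) := by
  intro t
  have hf : ∀ n, StronglyMeasurable[brownianFiltration t] fun ω ↦ ∑ s ∈ (clusterFinset hA hδ).powerset, pieceClockIncr κ hA hδ H s n t ω :=
    fun n ↦ by
    refine Finset.stronglyMeasurable_fun_sum _ fun s hs ↦ ?_
    have hs' := Finset.mem_powerset.1 hs
    obtain ⟨had, hc, -⟩ := pieceClock_spec (κ := κ) hs' n
    have hprog : IsStronglyProgressive brownianFiltration (pieceClock κ hA hδ s n) :=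
      had.stronglyAdapted.isStronglyProgressive_of_continuous hc
    exact ((hprog.stronglyAdapted_stoppedProcess (isStoppingTime_thrSigma hH s)) t).sub
      ((hprog.stronglyAdapted_stoppedProcess (isStoppingTime_thrRho hH hs')) t)
  have hlim := stronglyMeasurable_of_tendsto atTop hf (tendsto_pi_nhds.2 fun ω ↦ tendsto_sum_pieceClockIncr (hHt ω) (hclw ω) t)
  have heq : (fun ω ↦ thrClock (drvK κ (brownianCPath ω)) A (min (t : ℝ) (((H ω).untopD 0 : ℝ≥0) : ℝ))) =
      fun ω ↦ thrClock (drvK κ (brownianCPath ω)) A ((min (t : WithTop ℝ≥0) (H ω)).untopA : ℝ≥0) := by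
    funext ω; rw [min_untopD_eq (hHt ω)]
  show Measurable[brownianFiltration t] fun ω ↦ thrClock (drvK κ (brownianCPath ω)) A (min (t : ℝ) (((H ω).untopD 0 : ℝ≥0) : ℝ))
  rw [heq]
  exact hlim.measurable

/-- **The gluing theorem ([LSW 2001] Thm. 2.2 / Lawler (2005) Thm. 6.13, through the swallow instants):
the stopped through-swallow image driving value of SLE₆ under a `*`-hull `A`, divided by `√6`, carries the
through-swallow capacity clock** in the sense of `Process.HasMartingaleClock`. Hypotheses on the horizon `H`:
a stopping time bounded by the cap time `capTimeK 6 N` and by the constant `T₀`, up to which every `δ`-cluster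
of `A` is swallowed whole or untouched by the closed hulls. Proof: the process stopped at `H` is the finite sum,
over the subfamilies `s` of clusters, of its increments over the stochastic intervals `[ρ_s, σ_s)` on which the
remaining hull is `A ∖ ⋃ s`; each increment is the limit of the optional-stopping increments of the bounded
martingales `imgMartK` of the fixed `*`-hull `A ∖ ⋃ s` (`SLEImageMartingale`, `SLEImageBracketMartingale`),
continuous across the swallow instants (`Loewner.tendsto_starShift_slidHull_hullHitTime`), and the a.e.
martingale property passes to the uniformly bounded limit (`IsAEMartingale.of_tendsto_ae`); the same for the
compensated square with the clock `thrClock`. [cite: LawlerSchrammWerner2001, Thm. 2.2] -/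
theorem hasMartingaleClock_thrImageDriver {A : Set ℂ} (hA : IsStarHull A) {δ : ℝ} (hδ : 0 < δ)
    (H : (ℝ≥0 → ℝ) → WithTop ℝ≥0) (N : ℕ) (T₀ : ℝ≥0)
    (hH : IsStoppingTime brownianFiltration H)
    (hHcap : ∀ ω, H ω ≤ capTimeK 6 N ω) (hHT : ∀ ω, H ω ≤ (T₀ : WithTop ℝ≥0))
    (hclw : ∀ ω (t : ℝ≥0), (t : WithTop ℝ≥0) ≤ H ω → ∀ a ∈ A,
      deltaCluster A δ a ⊆ Loewner.closedHull (drvK 6 (brownianCPath ω)) t ∨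
        Disjoint (deltaCluster A δ a) (Loewner.closedHull (drvK 6 (brownianCPath ω)) t)) :
    ∃ C : ℝ, Process.HasMartingaleClock
      (fun t ω ↦ (Real.sqrt 6)⁻¹ * stoppedProcess (fun t ω ↦ Loewner.thrImageDriver (drvK 6 (brownianCPath ω)) A t) H t ω)
      (fun t ω ↦ Loewner.thrClock (drvK 6 (brownianCPath ω)) A (min (t : ℝ) (((H ω).untopD 0 : ℝ≥0) : ℝ)))
      brownianFiltration Process.preWienerMeasure C := by
  haveI := isProbabilityMeasure_preWienerMeasure'
  have hHt : ∀ ω, H ω ≠ ⊤ := fun ω ↦ ne_top_of_le_ne_top WithTop.coe_ne_top (hHT ω)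
  have h6 : (0 : ℝ) < Real.sqrt 6 := Real.sqrt_pos.2 (by norm_num)
  obtain ⟨R₁, hR₁⟩ := hA.isBoundedHull.isCompact.isBounded.subset_closedBall (0 : ℂ)
  set R : ℝ := max R₁ 1 with hR
  have hR0 : 0 < R := lt_max_of_lt_right one_pos
  have hAR : A ⊆ closedBall (0 : ℂ) R := hR₁.trans (closedBall_subset_closedBall (le_max_left _ _))
  set K : ℝ := ((N : ℝ) + 1) + 1160 * (3 * ((N : ℝ) + 1) + 13 * Real.sqrt T₀ + R) with hK
  set Pw := (clusterFinset hA hδ).powerset with hPw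
  set B₁ : ℝ := Pw.card * (2 * K) with hB₁
  set B₂ : ℝ := Pw.card * ((2 * K) ^ 2 + 6 * T₀ + 2 * (Pw.card * (2 * K)) * (2 * K)) with hB₂
  set U : ℝ≥0 → (ℝ≥0 → ℝ) → ℝ := stoppedProcess (fun t ω ↦ thrImageDriver (drvK 6 (brownianCPath ω)) A t) H with hUdef
  set c : ℝ≥0 → (ℝ≥0 → ℝ) → ℝ := fun t ω ↦ thrClock (drvK 6 (brownianCPath ω)) A (min (t : ℝ) (((H ω).untopD 0 : ℝ≥0) : ℝ)) with hcdef
  have hc_eq : ∀ t ω, c t ω = thrClock (drvK 6 (brownianCPath ω)) A ((min (t : WithTop ℝ≥0) (H ω)).untopA : ℝ≥0) := fun t ω ↦ by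
    rw [hcdef]; simp only; rw [min_untopD_eq (hHt ω)]
  -- the limits
  have hlimU : ∀ t ω, Tendsto (fun n ↦ thrLevelSum 6 hA hδ H n t ω) atTop (𝓝 (U t ω)) := fun t ω ↦ tendsto_thrLevelSum (hclw ω) t
  have hlimB : ∀ t ω, Tendsto (fun n ↦ thrLevelBracket 6 hA hδ H n t ω) atTop (𝓝 (U t ω ^ 2 - 6 * c t ω)) := fun t ω ↦ by
    rw [hc_eq]; exact tendsto_thrLevelBracket (hHt ω) (hclw ω) t
  -- the bounds
  have hbU : ∀ n t ω, |thrLevelSum 6 hA hδ H n t ω| ≤ B₁ := fun n t ω ↦ abs_thrLevelSum_le hHcap hHT hR0 hAR n t ω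
  have hbB : ∀ n t ω, |thrLevelBracket 6 hA hδ H n t ω| ≤ B₂ := fun n t ω ↦ abs_thrLevelBracket_le hHcap hHT hR0 hAR n t ω
  have hUle : ∀ t ω, |U t ω| ≤ B₁ := fun t ω ↦
    le_of_tendsto ((continuous_abs.tendsto _).comp (hlimU t ω)) (Eventually.of_forall fun n ↦ hbU n t ω)
  -- the a.e. martingales
  have hM1 : IsAEMartingale U brownianFiltration preWienerMeasure := by
    refine IsAEMartingale.of_tendsto_ae (Mk := fun n ↦ thrLevelSum 6 hA hδ H n) (fun n ↦ isAEMartingale_thrLevelSum hH n)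
      (fun t ↦ ?_) (fun t ↦ ae_of_all _ fun ω ↦ hlimU t ω)
    exact uniformIntegrable_of_abs_le (fun n ↦ ((isAEMartingale_thrLevelSum (hA := hA) (hδ := hδ) hH n).aestronglyMeasurable t).mono
      (brownianFiltration.le t)) fun n ↦ ae_of_all _ fun ω ↦ hbU n t ω
  have hM2 : IsAEMartingale (fun t ω ↦ U t ω ^ 2 - 6 * c t ω) brownianFiltration preWienerMeasure := by
    refine IsAEMartingale.of_tendsto_ae (Mk := fun n ↦ thrLevelBracket 6 hA hδ H n)
      (fun n ↦ isAEMartingale_thrLevelBracket hH hHcap hHT hR0 hAR n) (fun t ↦ ?_) (fun t ↦ ae_of_all _ fun ω ↦ hlimB t ω)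
    exact uniformIntegrable_of_abs_le (fun n ↦ ((isAEMartingale_thrLevelBracket (hA := hA) (hδ := hδ) hH hHcap hHT hR0 hAR n).aestronglyMeasurable t).mono
      (brownianFiltration.le t)) fun n ↦ ae_of_all _ fun ω ↦ hbB n t ω
  -- the clock
  have hclock : ∀ ω ⦃s t : ℝ≥0⦄, s ≤ t → c s ω ≤ c t ω ∧ c t ω - c s ω ≤ (t : ℝ) - s := by
    intro ω s t hst
    obtain ⟨h, hh⟩ := WithTop.ne_top_iff_exists.1 (hHt ω)
    have hint := integrableOn_thrClockRate_of_clusterwise (κ := 6) hA hδ (ω := ω) (h := h)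
      fun u hu ↦ hclw ω u (by rw [← hh]; exact WithTop.coe_le_coe.2 hu)
    rw [hcdef]; simp only [← hh, WithTop.untopD_coe]
    rcases (min_le_min_right (h : ℝ) (NNReal.coe_le_coe.2 hst)).eq_or_lt with heq | hlt
    · rw [heq]; constructor
      · exact le_rfl
      · rw [sub_self]; exact sub_nonneg.2 (NNReal.coe_le_coe.2 hst)
    · have := thrClock_sub_mem hint (le_min s.coe_nonneg h.coe_nonneg) hlt (min_le_right _ _)
      constructor
      · linarith [this.1]
      · linarith [this.2, min_sub_min_le_sub (NNReal.coe_le_coe.2 hst) (σ := (h : ℝ))]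
  refine ⟨(Real.sqrt 6)⁻¹ * B₁, ?_⟩
  have hsq : ((Real.sqrt 6)⁻¹) ^ 2 = (6 : ℝ)⁻¹ := by rw [inv_pow, Real.sq_sqrt (by norm_num)]
  exact
    { isAEMartingale := hM1.const_mul _
      isAEMartingale_sq_sub := by
        refine (hM2.const_mul ((6 : ℝ)⁻¹)).congr fun t ↦ Eventually.of_forall fun ω ↦ ?_
        show (6 : ℝ)⁻¹ * (U t ω ^ 2 - 6 * c t ω) = ((Real.sqrt 6)⁻¹ * U t ω) ^ 2 - c t ω
        rw [mul_pow, hsq]; field_simp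
      clock_zero := fun ω ↦ by
        show thrClock (drvK 6 (brownianCPath ω)) A (min ((0 : ℝ≥0) : ℝ) (((H ω).untopD 0 : ℝ≥0) : ℝ)) = 0
        rw [NNReal.coe_zero, min_eq_left (NNReal.coe_nonneg _), thrClock_zero]
      clock_mono := fun ω s t hst ↦ (hclock ω hst).1
      clock_sub_le := fun ω s t hst ↦ (hclock ω hst).2
      abs_le := Eventually.of_forall fun ω t ↦ by
        rw [abs_mul, abs_of_pos (inv_pos.2 h6)]
        exact mul_le_mul_of_nonneg_left (hUle t ω) (inv_pos.2 h6).le }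

/-- **Export (2): the process `Y = (√6)⁻¹ U*_{· ∧ H}` is strongly adapted.** [folklore] -/
theorem stronglyAdapted_thrY {A : Set ℂ} (hA : IsStarHull A) {δ : ℝ} (hδ : 0 < δ) {H : (ℝ≥0 → ℝ) → WithTop ℝ≥0}
    (hH : IsStoppingTime brownianFiltration H)
    (hclw : ∀ ω (t : ℝ≥0), (t : WithTop ℝ≥0) ≤ H ω → ∀ a ∈ A,
      deltaCluster A δ a ⊆ Loewner.closedHull (drvK 6 (brownianCPath ω)) t ∨
        Disjoint (deltaCluster A δ a) (Loewner.closedHull (drvK 6 (brownianCPath ω)) t)) :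
    StronglyAdapted brownianFiltration
      (fun t ω ↦ (Real.sqrt 6)⁻¹ * stoppedProcess (fun t ω ↦ Loewner.thrImageDriver (drvK 6 (brownianCPath ω)) A t) H t ω) :=
  fun t ↦ ((stronglyAdapted_stoppedProcess_thrImageDriver (κ := 6) hA hδ hH hclw) t).const_mul _

/-- **Export (3): the process `Y` has continuous paths.** [folklore] -/
theorem continuous_thrY {A : Set ℂ} (hA : IsStarHull A) {δ : ℝ} (hδ : 0 < δ) {H : (ℝ≥0 → ℝ) → WithTop ℝ≥0}
    (hHt : ∀ ω, H ω ≠ ⊤)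
    (hclw : ∀ ω (t : ℝ≥0), (t : WithTop ℝ≥0) ≤ H ω → ∀ a ∈ A,
      deltaCluster A δ a ⊆ Loewner.closedHull (drvK 6 (brownianCPath ω)) t ∨
        Disjoint (deltaCluster A δ a) (Loewner.closedHull (drvK 6 (brownianCPath ω)) t)) (ω : ℝ≥0 → ℝ) :
    Continuous fun t ↦ (Real.sqrt 6)⁻¹ * stoppedProcess (fun t ω ↦ Loewner.thrImageDriver (drvK 6 (brownianCPath ω)) A t) H t ω :=
  continuous_const.mul (continuous_stoppedProcess_thrImageDriver (κ := 6) hA hδ (hHt ω) (hclw ω))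

/-- **Export (4): the clock process `c t ω = thrClock W A (t ∧ H ω)` is adapted.** [folklore] -/
theorem adapted_thrClockProc {A : Set ℂ} (hA : IsStarHull A) {δ : ℝ} (hδ : 0 < δ) {H : (ℝ≥0 → ℝ) → WithTop ℝ≥0}
    (hH : IsStoppingTime brownianFiltration H) (hHt : ∀ ω, H ω ≠ ⊤)
    (hclw : ∀ ω (t : ℝ≥0), (t : WithTop ℝ≥0) ≤ H ω → ∀ a ∈ A,
      deltaCluster A δ a ⊆ Loewner.closedHull (drvK 6 (brownianCPath ω)) t ∨
        Disjoint (deltaCluster A δ a) (Loewner.closedHull (drvK 6 (brownianCPath ω)) t)) :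
    Adapted brownianFiltration
      (fun t ω ↦ Loewner.thrClock (drvK 6 (brownianCPath ω)) A (min (t : ℝ) (((H ω).untopD 0 : ℝ≥0) : ℝ))) :=
  adapted_thrClock_min (κ := 6) hA hδ hH hHt hclw

end Assembly

end Literature.Probability.RandomPlanarGeometry

end
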